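import Literature.Computability.Complexity.MaxCutGadgetMachine
import Literature.Computability.Complexity.MaxCutNP
import HarnessLib

/-!
# Weighted MAX CUT is NP-complete (Karp 1972, Main Theorem, problem 21): discharge of `isNPComplete_MAXCUT`

The named fact `isNPComplete_MAXCUT : IsNPComplete MAXCUT` of `KarpProblems.lean` (**pnp.S10**, Karp's
Main Theorem, problem 21 of 21; Garey–Johnson [ND16]) is assembled from its two halves:

* membership `MAXCUT_mem_NP` (`MaxCutNP.lean`: the weighted-graph-code test and the cut verifier in
  `P`, `MAXCUT = codeLang ⊓ witnessLang`);
* hardness `MAXCUT_isNPHard` (`MaxCutGadgetMachine.lean`: `ONEIN3SAT ≤ₚ MAXCUT` by the twin/pole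
  transformation of `MaxCutGadget.lean`, on top of the tree's `Schaefer1978_oneInThreeSAT_NPHard_holds`,
  itself on top of the Cook–Levin theorem `isNPComplete_kSAT_three_holds`).

The proof route (ONE-IN-THREE 3SAT → MAX CUT) is ours; Karp's printed chain reaches MAX CUT from
PARTITION and Garey–Johnson's entry cites MAX 2-SAT — the THEOREM is Karp's, the transformation is not.
(`MaxCutGadget.lean` announced this assembly under the name `KarpProblemsProofs.lean`; it is placed in
its own file so that the per-problem discharges of Karp's list stay independent of one another.)

## References

* R. M. Karp, *Reducibility among combinatorial problems*, in: R. E. Miller, J. W. Thatcher (eds.),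
  Complexity of Computer Computations, Plenum 1972, 85–103, §4, Main Theorem, problem 21 (MAX CUT).
* M. R. Garey, D. S. Johnson, *Computers and Intractability*, Freeman 1979, [ND16] MAX CUT (p. 210).
-/

namespace Literature.Computability.Complexity

/-- **Discharge of `isNPComplete_MAXCUT`** (Karp 1972, Main Theorem, problem 21 of 21): weighted MAX CUT —
the tree's `MAXCUT = (encodingNatMatrix.pairBool encodingNatBool).toLanguage maxCutSet` — is NP-complete:
`MAXCUT ∈ NP` (`MAXCUT_mem_NP`) and `MAXCUT` is NP-hard (`MAXCUT_isNPHard`).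
[cite: Karp1972, §4 Main Theorem, problem 21] -/
theorem isNPComplete_MAXCUT_holds : isNPComplete_MAXCUT := ⟨MAXCUT_mem_NP, MAXCUT_isNPHard⟩

end Literature.Computability.Complexity
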